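import Summits.Ventures.Crystal3D.Theorems.StickyWulffConstantCoaxialWallLawBarlowPlateSphere
import Summits.Ventures.Crystal3D.Theorems.StickyWulffConstantCoaxialWallLawBlockedWindow
import Summits.Ventures.Crystal3D.Theorems.StickyWulffConstantGenericWallFloorShellCount
import HarnessLib

/-!
# The clamped Barlow plates of a wall cell: core depth and SEALING, in the census's coordinates (F_layer L4 / OneFcc, cell hypotheses)

HONEST FRAMING. Venture `Summits/Ventures/Crystal3D` (cell `crystal3d-full`); helper `--supports` the crux `CoaxialWallLaw`
(stmt-Ventures-19481, REGISTERED line `WallLedgerF`) in its role as owner of lane T's debt T-F2 / F_layer; cf-p1 DECISION (civ):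
target `FLayerTwinFamilyOneFccAt` (…TexShadowFLayerSplitDefs).  Census-free, standard axioms; nothing about the crux is claimed;
F-C1 not moved.

Lane T's wall cell (`BilayerWallAt C R₀ …`, …TexShadowWallDefs) clamps the bottom plate `stacking L₁ s₁ σ₁` on
`W₁ = {−2R₀ ≤ z ≤ −R₀, x² + y² ≤ ρ²}` and the top plate on `W₂ = {h + R₀ ≤ z ≤ h + 2R₀, x² + y² ≤ ρ²}` (`P₁`, `P₂` = the plate sites
there, all in `X`).  The plate-abstract census (…PayerFamilyEndsPlates / …PayerEndPairsMultiPlates) is run with the SHIFTED constants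
`(R₀ + 1, ρ − 1)` so that every ball it reads has its radius-`2` ball inside a clamp (the readings of …BarlowPlateReadings /
…BarlowCoreRigidity / …BarlowPlateSources / …BarlowNoEntry need exactly that).  This file discharges the cell-level hypotheses:

* `plate_mem_of_clamp₁/₂` — the `hplate` form «every plate site in `Wᵢ` is a ball of `X`»;
* `coreBand₁_deep` — a ball of the bottom CORE BAND `P₁ ∩ {−R₀−3 ≤ z ≤ −R₀−2, x²+y² ≤ (ρ−2)²}` is a plate site `L₁ q + s₁` whose
  radius-`2` ball lies in `W₁` (`R₀ ≥ 5`); `topBand₂_deep` — the same for the top band `P₂ ∩ {h+R₀+2 ≤ z ≤ h+R₀+3, x²+y² ≤ (ρ−3)²}` in `W₂`;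
* **`sealing_below_barlow`** — the census's `hsealB` at `(R₀+1, ρ−1)`: every ball of `X` in the band `[−R₀−3, −R₀−2)` within lateral
  radius `ρ − 2` IS a core-band ball (covering radius `√(1/2)` of the plate + `1`-separation);
* **`sealing_above_barlow`** — the census's `hP₂seal` at `(R₀+1, ρ−1)`: every ball of `X` in `[h+R₀+2, h+R₀+3]` within lateral radius
  `ρ − 3` is a top-band ball.
WHAT THIS IS NOT: not the word net; F-C1 not moved.
-/

noncomputable section

namespace Summit.Ventures.Crystal3D.Theorems

open Summit.Ventures.Crystal3D Finset
open Literature.MathematicalPhysics.StatisticalMechanics (barlowPos barlowStacking IsHaggSeq barlowPos_mem)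
open Summit.Ventures.Crystal3D.Cruxes.TextureLiminf.TexShadow (E3 stacking)
open scoped InnerProductSpace

section Cell

variable {σ₁ σ₂ : ℤ → ℤ} (L₁ L₂ : E3 ≃ₗᵢ[ℝ] E3) (s₁ s₂ : E3) {X P₁ P₂ : Finset E3} {R₀ h ρ : ℝ}
  (hX : ∀ p ∈ X, ∀ q ∈ X, p ≠ q → 1 ≤ dist p q) (hP₁X : P₁ ⊆ X) (hP₂X : P₂ ⊆ X)
  (hP₁ : ∀ p, p ∈ P₁ ↔ (p ∈ stacking L₁ s₁ σ₁ ∧ -(2 * R₀) ≤ p 2 ∧ p 2 ≤ -R₀ ∧ p 0 ^ 2 + p 1 ^ 2 ≤ ρ ^ 2))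
  (hP₂ : ∀ p, p ∈ P₂ ↔ (p ∈ stacking L₂ s₂ σ₂ ∧ h + R₀ ≤ p 2 ∧ p 2 ≤ h + 2 * R₀ ∧ p 0 ^ 2 + p 1 ^ 2 ≤ ρ ^ 2))

/-- Coordinates are `1`-Lipschitz: `|y_i − p_i| ≤ dist y p`. -/
theorem abs_sub_apply_le_dist' (y p : E3) (i : Fin 3) : |y i - p i| ≤ dist y p := by
  have h := sq_sub_apply_le_dist_sq y p i
  have h0 : 0 ≤ dist y p := dist_nonneg
  nlinarith [sq_abs (y i - p i), abs_nonneg (y i - p i)]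

/-- Squaring a lateral bound: `√(x²+y²) ≤ a`, `0 ≤ a` ⇒ `x²+y² ≤ a²`. -/
theorem lateral_sq_le_of_sqrt_le {p : E3} {a : ℝ} (ha : 0 ≤ a) (h : Real.sqrt (p 0 ^ 2 + p 1 ^ 2) ≤ a) :
    p 0 ^ 2 + p 1 ^ 2 ≤ a ^ 2 := by
  have h0 : 0 ≤ p 0 ^ 2 + p 1 ^ 2 := by positivity
  have h1 : Real.sqrt (p 0 ^ 2 + p 1 ^ 2) ^ 2 = p 0 ^ 2 + p 1 ^ 2 := Real.sq_sqrt h0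
  have h2 : 0 ≤ Real.sqrt (p 0 ^ 2 + p 1 ^ 2) := Real.sqrt_nonneg _
  nlinarith

/-- Un-squaring: `x² + y² ≤ a²`, `0 ≤ a` ⇒ `√(x²+y²) ≤ a`. -/
theorem sqrt_lateral_le_of_sq_le {p : E3} {a : ℝ} (ha : 0 ≤ a) (h : p 0 ^ 2 + p 1 ^ 2 ≤ a ^ 2) :
    Real.sqrt (p 0 ^ 2 + p 1 ^ 2) ≤ a := by
  rw [← Real.sqrt_sq ha]; exact Real.sqrt_le_sqrt h

include hP₁X hP₁ in
/-- `hplate` for the bottom clamp: every plate site in `W₁` is a ball of `X`. -/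
theorem plate_mem_of_clamp₁ :
    ∀ p ∈ stacking L₁ s₁ σ₁, p ∈ {x : E3 | -(2 * R₀) ≤ x 2 ∧ x 2 ≤ -R₀ ∧ x 0 ^ 2 + x 1 ^ 2 ≤ ρ ^ 2} → p ∈ X :=
  fun p hp hw => hP₁X ((hP₁ p).2 ⟨hp, hw.1, hw.2.1, hw.2.2⟩)

include hP₂X hP₂ in
/-- `hplate` for the top clamp. -/
theorem plate_mem_of_clamp₂ :
    ∀ p ∈ stacking L₂ s₂ σ₂, p ∈ {x : E3 | h + R₀ ≤ x 2 ∧ x 2 ≤ h + 2 * R₀ ∧ x 0 ^ 2 + x 1 ^ 2 ≤ ρ ^ 2} → p ∈ X :=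
  fun p hp hw => hP₂X ((hP₂ p).2 ⟨hp, hw.1, hw.2.1, hw.2.2⟩)

include hP₁ in
/-- **Bottom core band balls are deep**: a plate site with its radius-`2` ball inside `W₁` (`R₀ ≥ 5`, `ρ ≥ 2`). -/
theorem coreBand₁_deep (hR₀ : 5 ≤ R₀) (hρ : 2 ≤ ρ) :
    ∀ p ∈ P₁.filter (fun p => -(R₀ + 1) - 1 - 1 ≤ p 2 ∧ p 2 ≤ -(R₀ + 1) - 1 ∧ p 0 ^ 2 + p 1 ^ 2 ≤ (ρ - 1 - 1) ^ 2),
      ∃ k i j : ℤ, p = L₁ (barlowPos 1 (Real.sqrt (2 / 3)) σ₁ k i j) + s₁ ∧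
        ∀ x, dist p x ≤ 2 → x ∈ {x : E3 | -(2 * R₀) ≤ x 2 ∧ x 2 ≤ -R₀ ∧ x 0 ^ 2 + x 1 ^ 2 ≤ ρ ^ 2} := by
  intro p hp
  obtain ⟨hpP, h1, h2, h3⟩ := mem_filter.1 hp
  obtain ⟨⟨q, ⟨k, i, j, rfl⟩, rfl⟩, -, -, -⟩ := (hP₁ _).1 hpP
  refine ⟨k, i, j, rfl, fun x hx => ?_⟩
  have hx2 := abs_sub_apply_le_dist' x (L₁ (barlowPos 1 (Real.sqrt (2 / 3)) σ₁ k i j) + s₁) 2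
  rw [dist_comm] at hx
  obtain ⟨hlo, hhi⟩ := abs_le.1 (hx2.trans hx)
  have hlat := lateral_radius_le_add_dist x (L₁ (barlowPos 1 (Real.sqrt (2 / 3)) σ₁ k i j) + s₁)
  have hpl := sqrt_lateral_le_of_sq_le (by linarith : (0 : ℝ) ≤ ρ - 1 - 1) h3
  refine ⟨by linarith, by linarith, lateral_sq_le_of_sqrt_le (by linarith) (by linarith)⟩

include hP₂ in
/-- **Top band balls are deep**: a plate site with its radius-`2` ball inside `W₂` (`R₀ ≥ 5`, `ρ ≥ 3`). -/
theorem topBand₂_deep (hR₀ : 5 ≤ R₀) (hρ : 3 ≤ ρ) :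
    ∀ p ∈ P₂.filter (fun p => h + (R₀ + 1) + 1 ≤ p 2 ∧ p 2 ≤ h + (R₀ + 1) + 1 + 1 ∧ p 0 ^ 2 + p 1 ^ 2 ≤ (ρ - 1 - 2) ^ 2),
      ∃ k i j : ℤ, p = L₂ (barlowPos 1 (Real.sqrt (2 / 3)) σ₂ k i j) + s₂ ∧
        ∀ x, dist p x ≤ 2 → x ∈ {x : E3 | h + R₀ ≤ x 2 ∧ x 2 ≤ h + 2 * R₀ ∧ x 0 ^ 2 + x 1 ^ 2 ≤ ρ ^ 2} := by
  intro p hp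
  obtain ⟨hpP, h1, h2, h3⟩ := mem_filter.1 hp
  obtain ⟨⟨q, ⟨k, i, j, rfl⟩, rfl⟩, -, -, -⟩ := (hP₂ _).1 hpP
  refine ⟨k, i, j, rfl, fun x hx => ?_⟩
  have hx2 := abs_sub_apply_le_dist' x (L₂ (barlowPos 1 (Real.sqrt (2 / 3)) σ₂ k i j) + s₂) 2
  rw [dist_comm] at hx
  obtain ⟨hlo, hhi⟩ := abs_le.1 (hx2.trans hx)
  have hlat := lateral_radius_le_add_dist x (L₂ (barlowPos 1 (Real.sqrt (2 / 3)) σ₂ k i j) + s₂)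
  have hpl := sqrt_lateral_le_of_sq_le (by linarith : (0 : ℝ) ≤ ρ - 1 - 2) h3
  refine ⟨by linarith, by linarith, lateral_sq_le_of_sqrt_le (by linarith) (by linarith)⟩

include hX hP₁X hP₁ in
/-- **SEALING BELOW (`hsealB` of the census at `(R₀+1, ρ−1)`)**: a ball of `X` in the band `[−R₀−3, −R₀−2)` within lateral radius
`ρ − 2` is a core-band ball of the bottom plate (`R₀ ≥ 4`, `ρ ≥ 2`). -/
theorem sealing_below_barlow (hR₀ : 4 ≤ R₀) (hρ : 2 ≤ ρ) :
    ∀ s ∈ X, s ∉ P₁.filter (fun p => -(R₀ + 1) - 1 - 1 ≤ p 2 ∧ p 2 ≤ -(R₀ + 1) - 1 ∧ p 0 ^ 2 + p 1 ^ 2 ≤ (ρ - 1 - 1) ^ 2) →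
      -(R₀ + 1) - 1 - 1 ≤ s 2 → s 2 < -(R₀ + 1) - 1 → s 0 ^ 2 + s 1 ^ 2 ≤ (ρ - 1 - 1) ^ 2 → False := by
  intro s hs hns h1 h2 h3
  obtain ⟨p, hp, hd⟩ := exists_site_near_of_stacking σ₁ L₁ s₁ s
  have hd1 : dist s p < 1 := by nlinarith [dist_nonneg (x := s) (y := p)]
  -- the near site is in the bottom clamp, hence a ball of `X`
  have hz := abs_sub_apply_le_dist' p s 2
  rw [dist_comm] at hz
  obtain ⟨hlo, hhi⟩ := abs_le.1 (hz.trans hd1.le)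
  have hlat := lateral_radius_le_add_dist p s
  rw [dist_comm] at hlat
  have hsl := sqrt_lateral_le_of_sq_le (by linarith : (0 : ℝ) ≤ ρ - 1 - 1) h3
  have hpP : p ∈ P₁ := (hP₁ p).2 ⟨hp, by linarith, by linarith,
    lateral_sq_le_of_sqrt_le (by linarith) (by linarith)⟩
  -- `1`-separation forces `s = p`
  have hsp : s = p := by
    by_contra hne
    have := hX s hs p (hP₁X hpP) hne
    linarith
  subst hsp
  exact hns (mem_filter.2 ⟨hpP, h1, h2.le, h3⟩)

include hX hP₂X hP₂ in
/-- **SEALING ABOVE (`hP₂seal` of the census at `(R₀+1, ρ−1)`)**: a ball of `X` in the band `[h+R₀+2, h+R₀+3]` within lateral radius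
`ρ − 3` is a top-band ball of the top plate (`R₀ ≥ 4`, `ρ ≥ 3`). -/
theorem sealing_above_barlow (hR₀ : 4 ≤ R₀) (hρ : 3 ≤ ρ) :
    ∀ s ∈ X, h + (R₀ + 1) + 1 ≤ s 2 → s 2 ≤ h + (R₀ + 1) + 1 + 1 → s 0 ^ 2 + s 1 ^ 2 ≤ (ρ - 1 - 2) ^ 2 →
      s ∈ P₂.filter (fun p => h + (R₀ + 1) + 1 ≤ p 2 ∧ p 2 ≤ h + (R₀ + 1) + 1 + 1 ∧ p 0 ^ 2 + p 1 ^ 2 ≤ (ρ - 1 - 2) ^ 2) := by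
  intro s hs h1 h2 h3
  obtain ⟨p, hp, hd⟩ := exists_site_near_of_stacking σ₂ L₂ s₂ s
  have hd1 : dist s p < 1 := by nlinarith [dist_nonneg (x := s) (y := p)]
  have hz := abs_sub_apply_le_dist' p s 2
  rw [dist_comm] at hz
  obtain ⟨hlo, hhi⟩ := abs_le.1 (hz.trans hd1.le)
  have hlat := lateral_radius_le_add_dist p s
  rw [dist_comm] at hlat
  have hsl := sqrt_lateral_le_of_sq_le (by linarith : (0 : ℝ) ≤ ρ - 1 - 2) h3
  have hpP : p ∈ P₂ := (hP₂ p).2 ⟨hp, by linarith, by linarith,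
    lateral_sq_le_of_sqrt_le (by linarith) (by linarith)⟩
  have hsp : s = p := by
    by_contra hne
    have := hX s hs p (hP₂X hpP) hne
    linarith
  subst hsp
  exact mem_filter.2 ⟨hpP, h1, h2, h3⟩

end Cell

end Summit.Ventures.Crystal3D.Theorems

end
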